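import Literature.Probability.Percolation.CoveringQuotientMap
import HarnessLib

/-!
# Tame fibres of the quotient map (Martineau–Severo 2019, Lemma 7.2, group case)

Second file of the inline proof of `Literature.Probability.Percolation.MartineauSevero2019_cor22`.
Martineau–Severo (Ann. Probab. 47 (2019), §2 and Lemma 7.2): the quotient map `π : 𝒢 → ℋ = 𝒢/Γ` "has tame
fibres: there is some `R` such that for every `x ∈ V(𝒢)`, there is some `y ∈ V(𝒢)` satisfying `π(x) = π(y)` and
`0 < d(x,y) ≤ R`", whenever `𝒢` and `ℋ` are quasi-transitive and `π` is non-injective (Lemma 7.2). We prove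
it for a nontrivial group `Γ` acting freely (hypothesis `∀ g x, g • x = x → g = 1`, as in the parent fact)
by automorphisms (`exists_tame`:
`∃ R, ∀ x, ∃ g ≠ 1, g • x ∈ B_R(x)`), following the printed proof with one simplification: the printed proof
first shows by a compactness/diagonal argument on rooted balls that `|B_r(x)| > |B_r(π x)|` for a uniform
`r`; here the uniformity is obtained directly by pigeonhole over the finitely many pairs
(`Aut(𝒢)`-representative of `x`, `Aut(ℋ)`-representative of `π x`) — ball volumes are automorphism
invariant, the strict inequality holds at SOME radius for every `x` (the ball containing `x` and `g x`), and
strictness persists at larger radii. The second half is as printed: two points `y ≠ z = g y` of `B_r(x)` in one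
fibre give `d(x, g x) ≤ d(x, z) + d(g y, g x) ≤ 2r` (in the group case no disjoint path lifting is needed).

Also here: elementary bookkeeping on `graphBall` (symmetry, triangle inequality, automorphism invariance of
`ballVolume`, comparison with `SimpleGraph.dist`).

## References

* S. Martineau, F. Severo, Ann. Probab. 47 (2019), §2 (tame fibres), §7 Lemma 7.2 and its proof
  [MartineauSevero2019].
-/

namespace Literature.Probability.Percolation

open Literature.Barriers.CriticalPhenomena

variable {V : Type*}

/-! ### Bookkeeping on balls -/

/-- Balls are symmetric: `y ∈ B_n(x) ↔ x ∈ B_n(y)` (reverse the walk). [folklore] -/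
theorem mem_graphBall_comm (G : SimpleGraph V) {x y : V} {n : ℕ} :
    y ∈ graphBall G x n ↔ x ∈ graphBall G y n := by
  constructor
  · rintro ⟨w, hw⟩; exact ⟨w.reverse, by rw [SimpleGraph.Walk.length_reverse]; exact hw⟩
  · rintro ⟨w, hw⟩; exact ⟨w.reverse, by rw [SimpleGraph.Walk.length_reverse]; exact hw⟩

/-- Triangle inequality for balls: `y ∈ B_m(x)`, `z ∈ B_n(y)` give `z ∈ B_{m+n}(x)`. [folklore] -/
theorem mem_graphBall_add (G : SimpleGraph V) {x y z : V} {m n : ℕ} (hy : y ∈ graphBall G x m)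
    (hz : z ∈ graphBall G y n) : z ∈ graphBall G x (m + n) := by
  obtain ⟨w₁, h₁⟩ := hy
  obtain ⟨w₂, h₂⟩ := hz
  exact ⟨w₁.append w₂, by rw [SimpleGraph.Walk.length_append]; omega⟩

/-- Adjacent vertices are in each other's unit ball. [folklore] -/
theorem mem_graphBall_one_of_adj (G : SimpleGraph V) {x y : V} (h : G.Adj x y) : y ∈ graphBall G x 1 :=
  ⟨SimpleGraph.Walk.cons h SimpleGraph.Walk.nil, le_rfl⟩

/-- For a connected graph, `B_n(x) = {y | dist(x,y) ≤ n}`. [folklore] -/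
theorem mem_graphBall_iff_dist_le {G : SimpleGraph V} (hG : G.Connected) {x y : V} {n : ℕ} :
    y ∈ graphBall G x n ↔ G.dist x y ≤ n := by
  constructor
  · rintro ⟨w, hw⟩
    exact (SimpleGraph.dist_le w).trans hw
  · intro h
    obtain ⟨w, hw⟩ := hG.exists_walk_length_eq_dist x y
    exact ⟨w, hw ▸ h⟩

/-- Automorphisms map balls onto balls: `B_n(γ x) = γ(B_n(x))`. [folklore] -/
theorem graphBall_map_eq_image {G : SimpleGraph V} (γ : G ≃g G) (x : V) (n : ℕ) :
    graphBall G (γ x) n = γ '' graphBall G x n := by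
  ext z
  constructor
  · intro hz
    refine ⟨γ.symm z, ?_, γ.apply_symm_apply z⟩
    have := mem_graphBall_map γ.symm hz
    simpa using this
  · rintro ⟨y, hy, rfl⟩
    exact mem_graphBall_map γ hy

/-- **Ball volumes are automorphism invariant**: `|B_n(γ x)| = |B_n(x)|`. [folklore] -/
theorem ballVolume_map_eq {G : SimpleGraph V} (γ : G ≃g G) (x : V) (n : ℕ) :
    ballVolume G (γ x) n = ballVolume G x n := by
  rw [ballVolume, ballVolume, graphBall_map_eq_image, Set.ncard_image_of_injective _ γ.injective]

section Tame

variable {Γ : Type*} [Group Γ] [MulAction Γ V]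

/-! ### Strict volume drop at some radius, and its persistence -/

/-- For a free action of a nontrivial group by automorphisms of a connected graph, every vertex has a radius
at which the quotient ball is strictly smaller: `|B_n(π x)| < |B_n(x)|` (the ball containing `x` and `g x`).
[cite: MartineauSevero2019, §7 proof of Lemma 7.2] -/
theorem exists_ballVolume_quot_lt [Nontrivial Γ] {G : SimpleGraph V} [G.LocallyFinite] (hact : IsActionByAut G Γ)
    (hfree : ∀ (g : Γ) (x : V), g • x = x → g = 1) (hG : G.Connected) (x : V) :
    ∃ n : ℕ, ballVolume (orbitQuotientGraph G Γ) (qmk Γ x) n < ballVolume G x n := by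
  obtain ⟨g, hg⟩ := exists_ne (1 : Γ)
  obtain ⟨w⟩ := hG.preconnected x (g • x)
  refine ⟨w.length, ballVolume_quot_lt hact (mem_graphBall_self G x _) ⟨w, le_rfl⟩ ?_ (qmk_smul Γ g x).symm⟩
  intro h
  exact hg (hfree g x h.symm)

/-- Strictness persists at larger radii. [cite: MartineauSevero2019, §7 proof of Lemma 7.2] -/
theorem ballVolume_quot_lt_of_le {G : SimpleGraph V} [G.LocallyFinite] (hact : IsActionByAut G Γ) {x : V}
    {m n : ℕ} (h : ballVolume (orbitQuotientGraph G Γ) (qmk Γ x) m < ballVolume G x m) (hmn : m ≤ n) :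
    ballVolume (orbitQuotientGraph G Γ) (qmk Γ x) n < ballVolume G x n := by
  obtain ⟨y, hy, z, hz, hyz, hq⟩ := exists_ne_qmk_eq_of_ballVolume_lt hact h
  exact ballVolume_quot_lt hact (graphBall_mono G x hmn hy) (graphBall_mono G x hmn hz) hyz hq

/-! ### Uniform radius by pigeonhole over type pairs -/

/-- **Uniform strict volume drop** (the `r` of [MartineauSevero2019, proof of Lemma 7.2]): if `𝒢` and
`ℋ = 𝒢/Γ` are quasi-transitive there is ONE radius `n` with `|B_n(π x)| < |B_n(x)|` for every `x`.
Pigeonhole over the finitely many pairs of orbit representatives, automorphism invariance of volumes, and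
persistence of strictness. [cite: MartineauSevero2019, §7 Lemma 7.2 (proof, existence of r)] -/
theorem exists_uniform_ballVolume_quot_lt [Nontrivial Γ] {G : SimpleGraph V} [G.LocallyFinite]
    (hact : IsActionByAut G Γ) (hfree : ∀ (g : Γ) (x : V), g • x = x → g = 1) (hG : G.Connected) (hqG : IsQuasiTransitive G)
    (hqH : IsQuasiTransitive (orbitQuotientGraph G Γ)) :
    ∃ n : ℕ, ∀ x : V, ballVolume (orbitQuotientGraph G Γ) (qmk Γ x) n < ballVolume G x n := by
  classical
  haveI := quotLocallyFinite hact
  obtain ⟨V₀, hV₀⟩ := hqG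
  obtain ⟨W₀, hW₀⟩ := hqH
  -- representatives
  set γ : V → G ≃g G := fun x => (hV₀ x).choose with hγ
  have hγm : ∀ x, γ x x ∈ V₀ := fun x => (hV₀ x).choose_spec
  set δ : MulAction.orbitRel.Quotient Γ V → (orbitQuotientGraph G Γ ≃g orbitQuotientGraph G Γ) :=
    fun u => (hW₀ u).choose with hδ
  have hδm : ∀ u, δ u u ∈ W₀ := fun u => (hW₀ u).choose_spec
  set t : V → V × MulAction.orbitRel.Quotient Γ V := fun x => (γ x x, δ (qmk Γ x) (qmk Γ x)) with ht
  have htm : ∀ x, t x ∈ V₀ ×ˢ W₀ := fun x => Finset.mem_product.2 ⟨hγm x, hδm _⟩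
  -- radius per realised type
  set nf : V × MulAction.orbitRel.Quotient Γ V → ℕ := fun τ =>
    if h : ∃ x, t x = τ then (exists_ballVolume_quot_lt hact hfree hG h.choose).choose else 0 with hnf
  refine ⟨(V₀ ×ˢ W₀).sup nf, fun x => ?_⟩
  have hex : ∃ x', t x' = t x := ⟨x, rfl⟩
  set x' := hex.choose with hx'
  have htx' : t x' = t x := hex.choose_spec
  have hlt' : ballVolume (orbitQuotientGraph G Γ) (qmk Γ x') (nf (t x)) < ballVolume G x' (nf (t x)) := by
    have : nf (t x) = (exists_ballVolume_quot_lt hact hfree hG hex.choose).choose := by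
      rw [hnf]; exact dif_pos hex
    rw [this]
    exact (exists_ballVolume_quot_lt hact hfree hG hex.choose).choose_spec
  have hle : nf (t x) ≤ (V₀ ×ˢ W₀).sup nf := Finset.le_sup (htm x)
  have hlt := ballVolume_quot_lt_of_le hact hlt' hle
  -- transfer along the representatives
  have h1 : ballVolume G x ((V₀ ×ˢ W₀).sup nf) = ballVolume G x' ((V₀ ×ˢ W₀).sup nf) := by
    rw [← ballVolume_map_eq (γ x) x, ← ballVolume_map_eq (γ x') x']
    have : γ x x = γ x' x' := (congrArg Prod.fst htx').symm
    rw [this]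
  have h2 : ballVolume (orbitQuotientGraph G Γ) (qmk Γ x) ((V₀ ×ˢ W₀).sup nf) =
      ballVolume (orbitQuotientGraph G Γ) (qmk Γ x') ((V₀ ×ˢ W₀).sup nf) := by
    rw [← ballVolume_map_eq (δ (qmk Γ x)) (qmk Γ x), ← ballVolume_map_eq (δ (qmk Γ x')) (qmk Γ x')]
    have : δ (qmk Γ x) (qmk Γ x) = δ (qmk Γ x') (qmk Γ x') := (congrArg Prod.snd htx').symm
    rw [this]
  rw [h1, h2]
  exact hlt

/-! ### Tame fibres -/

/-- **Tame fibres (Martineau–Severo 2019, Lemma 7.2, for quotients by free actions).** If `𝒢` is connected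
and locally finite, `Γ ≠ {1}` acts freely by automorphisms, and `𝒢`, `𝒢/Γ` are quasi-transitive, then there is
`R` such that every vertex `x` has a translate `g x ≠ x` (i.e. `g ≠ 1`) within distance `R`:
`g • x ∈ B_R(x)`. [cite: MartineauSevero2019, Lemma 7.2] -/
theorem exists_tame [Nontrivial Γ] {G : SimpleGraph V} [G.LocallyFinite] (hact : IsActionByAut G Γ)
    (hfree : ∀ (g : Γ) (x : V), g • x = x → g = 1) (hG : G.Connected) (hqG : IsQuasiTransitive G)
    (hqH : IsQuasiTransitive (orbitQuotientGraph G Γ)) :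
    ∃ R : ℕ, ∀ x : V, ∃ g : Γ, g ≠ 1 ∧ g • x ∈ graphBall G x R := by
  obtain ⟨n, hn⟩ := exists_uniform_ballVolume_quot_lt hact hfree hG hqG hqH
  refine ⟨n + n, fun x => ?_⟩
  obtain ⟨y, hy, z, hz, hyz, hq⟩ := exists_ne_qmk_eq_of_ballVolume_lt hact (hn x)
  obtain ⟨g, rfl⟩ := (qmk_eq_iff Γ y z).1 hq
  refine ⟨g, ?_, ?_⟩
  · rintro rfl
    exact hyz (one_smul Γ z)
  · have hxz : x ∈ graphBall G z n := (mem_graphBall_comm G).1 hz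
    have h1 : g • x ∈ graphBall G (g • z) n := (smul_mem_graphBall_iff hact g).2 hxz
    exact mem_graphBall_add G hy h1

/-- The tameness radius can be taken `≥ 1` (indeed any larger radius works). [cite: MartineauSevero2019, Lemma 7.2] -/
theorem exists_tame_pos [Nontrivial Γ] {G : SimpleGraph V} [G.LocallyFinite] (hact : IsActionByAut G Γ)
    (hfree : ∀ (g : Γ) (x : V), g • x = x → g = 1) (hG : G.Connected) (hqG : IsQuasiTransitive G)
    (hqH : IsQuasiTransitive (orbitQuotientGraph G Γ)) :
    ∃ R : ℕ, 1 ≤ R ∧ ∀ x : V, ∃ g : Γ, g ≠ 1 ∧ g • x ∈ graphBall G x R := by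
  obtain ⟨R, hR⟩ := exists_tame hact hfree hG hqG hqH
  refine ⟨R + 1, Nat.le_add_left 1 R, fun x => ?_⟩
  obtain ⟨g, hg, hgx⟩ := hR x
  exact ⟨g, hg, graphBall_mono G x (Nat.le_succ R) hgx⟩

end Tame

end Literature.Probability.Percolation
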